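import Literature.NumberTheory.EllipticCurves.Tian2014.CMPointSystemBridgeCusp
import HarnessLib

/-!
# The sign relation «`f = ±ϕ`» (display M2 of the maximal bridge, PROOF-A (8.1.1)) as a KERNEL THEOREM of Tian's
# printed uniqueness sentence «Such `f` is unique up to multiplication by `−1`» instantiated at two printed instances —
# Tian's `f` and TYZ's `ϕ`, both «a modular parametrization of degree 2» of `X₀(32)` mapping `[∞]` to `0`

Cell `bsd-monsky` (typer seat, g5; referee B ROUND 253: the route-A marks of record are the three READINGS `fEqPhi`,
`tianTB`, `tyzZN`, each «one line from print»; R249.1: a displayed sentence that is not printed carries a mark, a kernel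
theorem of printed sentences does not). HONEST FRAMING: nothing asserted; every `def … : Prop` below is a displayed
sentence of Tian 2014 (`pNNNN LMM` = page:line of the materialised arXiv text, `J` = journal page) or of Tian–Yuan–Zhang
2017 on abstract DATA, and the kernel theorem is the instantiation of a displayed universal sentence at two displayed
instances.

## The datum: the predicate «degree-`2` modular parametrisation `X₀(32) → E` mapping `[∞]` to `0`»

Tian p0003 L2–L5: «there is a degree 2 modular parametrization `f : X₀(32) → E` mapping `[∞]` to `0`. Such `f` is unique
up to multiplication by `−1` because the elliptic curve `(X₀(32), [∞])` has only one rational torsion point of order 2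
(see Proposition 2.2).» The notion «degree-`2` modular parametrization `X₀(32) → E` (over `ℚ`) mapping `[∞]` to `0`» is
recorded as an abstract predicate `IsDegTwoParam` on the additive maps `A → E(ℂ)` (the map on complex points induced by
such a morphism); nothing about it is asserted beyond the three displayed sentences.

## The displays (one printed sentence each)

* `tianUnique` — «Such `f` is unique up to multiplication by `−1`» (p0003 L3–L5, J119): any two degree-`2` modular
  parametrisations mapping `[∞]` to `0` differ by a sign.
* `tianFParam` — «Let `f : X₀(32) → E` be a fixed modular parametrization over `ℚ` of degree 2 mapping the cusp `[∞]` at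
  the infinity on `X₀(32)` to the zero element `0 ∈ E`» (p0005 L77–L79, J123): `f` is such a parametrisation.
* `tyzPhiParam` — «Let `ϕ : X₀(32) → E` be a modular parametrization of degree `2`» (TYZ §2, p0007 L112, J733) and
  «Let `ϕ : A → E` be the isogeny of degree 2» (J751, p0016 L45; an isogeny from `A = (X₀(32), [∞])` maps `[∞]` to `0`):
  `ϕ` is such a parametrisation.

## The kernel content

`fEqPhi_of_paramDisplays`: `tianUnique` at `(f, ϕ)` gives `f = ϕ` or `f = −ϕ`, i.e. display M2 `fEqPhi` (`∃ ε = ±1, ∀ a,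
f a = ε • ϕ a`). Then `ParamCuspDisplays ⟹ CuspDisplays`, `GrossZagierParam ⟹ GrossZagierCusp`, and the restated fact
`tian2014_system_sMinus_param` (M2 replaced by the predicate and its three printed sentences, M7 replaced by `τ` and its
two printed sentences as in `CMPointSystemBridgeCusp.lean`) implies `tian2014_system_sMinus_cusp`, hence every enclosure
form of C-P2-1. Nothing booked; no mark moved by this file alone.
[cite: Tian2014, p0003 L1–L5 (J119), §2 (p0005 L76–L79, J123), Prop. 2.2]
[cite: TianYuanZhang2017, §2 (p0007 L112; J733), J751 (p0016 L45)]
-/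

noncomputable section

open scoped Classical

open WeierstrassCurve NumberField Literature.NumberTheory.EllipticCurves
  Literature.NumberTheory.EllipticCurves.TianYuanZhang2017

namespace Literature.NumberTheory.EllipticCurves.Tian2014

namespace CMPointData

variable {n : ℕ}

namespace BridgeData

variable {D : CMPointData n} (B : D.BridgeData)

/-! ## §1 The datum: the predicate «degree-`2` modular parametrisation mapping `[∞]` to `0`» -/

/-- **The notion «degree-`2` modular parametrization `X₀(32) → E` (over `ℚ`) mapping `[∞]` to `0`» as data** (objects
only; nothing asserted): an abstract predicate on the additive maps `A = X₀(32)(ℂ) → E(ℂ)`, holding of the map on complex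
points induced by such a morphism. [cite: Tian2014, p0003 L2–L3 (J119), §2 (p0005 L77–L79, J123)] -/
structure ParamData : Type where
  /-- «`g` is a degree-`2` modular parametrization `X₀(32) → E` mapping `[∞]` to `0`», on complex points -/
  IsDegTwoParam : (B.A →+ EPoint ℂ) → Prop

namespace ParamData

variable {B} (Q : B.ParamData)

/-! ## §2 The displays -/

/-- **«Such `f` is unique up to multiplication by `−1`»** — any two degree-`2` modular parametrisations `X₀(32) → E`
mapping `[∞]` to `0` differ by a sign. [cite: Tian2014, p0003 L3–L5 (J119), Prop. 2.2] -/
def tianUnique : Prop :=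
  ∀ g₁ g₂ : B.A →+ EPoint ℂ, Q.IsDegTwoParam g₁ → Q.IsDegTwoParam g₂ → (g₁ = g₂ ∨ g₁ = -g₂)

/-- **«Let `f : X₀(32) → E` be a fixed modular parametrization over `ℚ` of degree 2 mapping the cusp `[∞]` at the
infinity on `X₀(32)` to the zero element `0 ∈ E`»** — Tian's `f` is such a parametrisation.
[cite: Tian2014, §2 (p0005 L77–L79, J123), p0003 L2–L3] -/
def tianFParam : Prop :=
  Q.IsDegTwoParam B.f

/-- **«Let `ϕ : X₀(32) → E` be a modular parametrization of degree `2`»** (TYZ §2) and **«Let `ϕ : A → E` be the isogeny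
of degree 2»** (J751; an isogeny from `A = (X₀(32), [∞])` maps `[∞]` to `0`) — TYZ's `ϕ` is such a parametrisation.
[cite: TianYuanZhang2017, §2 (p0007 L112; J733), J751 (p0016 L45)] -/
def tyzPhiParam : Prop :=
  Q.IsDegTwoParam B.phi

/-- The three printed sentences on the predicate together.
[cite: Tian2014, p0003 L2–L5 (J119), §2 (p0005 L77–L79)] [cite: TianYuanZhang2017, §2 (p0007 L112), J751] -/
def ParamDisplays : Prop :=
  Q.tianUnique ∧ Q.tianFParam ∧ Q.tyzPhiParam

/-! ## §3 The kernel content: M2 is a theorem of the three sentences -/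

/-- **Display M2 of the maximal bridge (`f = ±ϕ`, PROOF-A (8.1.1)) is a KERNEL THEOREM of the three printed sentences**:
Tian's uniqueness sentence instantiated at `f` and `ϕ`.
[cite: Tian2014, p0003 L3–L5 (J119), §2 (p0005 L77–L79)] [cite: TianYuanZhang2017, §2 (p0007 L112), J751] -/
theorem fEqPhi_of_paramDisplays (h : Q.ParamDisplays) : B.fEqPhi := by
  obtain ⟨hU, hF, hP⟩ := h
  rcases hU B.f B.phi hF hP with hfp | hfp
  · exact ⟨1, Or.inl rfl, fun a => by rw [hfp, one_smul]⟩
  · exact ⟨-1, Or.inr rfl, fun a => by rw [hfp, AddMonoidHom.neg_apply, neg_smul, one_smul]⟩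

end ParamData

/-! ## §4 The seven displays with M2 and M7 both split into printed sentences -/

/-- **The maximal displays with M2 and M7 split into print**: M1, M3, M4, M5, M6 of `CMPointSystemBridgeMaximal.lean`
unchanged; in place of `f = ±ϕ` the predicate «degree-`2` modular parametrisation mapping `[∞]` to `0`» with Tian's
uniqueness sentence and the two printed instances (`ParamDisplays`); in place of `2·ϕ([i][0]) = 0` TYZ's `τ` with its two
printed sentences (`TauDisplays`, `CMPointSystemBridgeCusp.lean`).
[cite: Tian2014, Def. 2.7, Prop. 2.1, p0003 L1–L5, §2 (p0005 L77–L79)] [cite: TianYuanZhang2017, §2 (p0007 L112), §3.1, §3.2 (p0012 L16), J747, J751, Lemma 3.16 (p0017 L111)] -/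
def ParamCuspDisplays (w : EPoint D.H) : Prop :=
  B.tianDefZ ∧ (∃ Q : B.ParamData, Q.ParamDisplays) ∧ B.tianTA ∧ B.tianTB ∧ B.tyzZN ∧ B.wEqPhiZN w ∧
    ∃ C : B.TauData, C.TauDisplays

/-- `ParamCuspDisplays ⟹ CuspDisplays` (M2 is a theorem of the three printed sentences on the predicate).
[cite: Tian2014, p0003 L3–L5 (J119)] [cite: TianYuanZhang2017, §2 (p0007 L112), J751] -/
theorem cuspDisplays_of_paramCuspDisplays {w : EPoint D.H} (h : B.ParamCuspDisplays w) : B.CuspDisplays w := by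
  obtain ⟨h1, ⟨Q, hQ⟩, h3, h4, h5, h6, hC⟩ := h
  exact ⟨h1, Q.fEqPhi_of_paramDisplays hQ, h3, h4, h5, h6, hC⟩

end BridgeData

/-! ## §5 The Gross–Zagier relation with the split displays, and the restated system fact -/

/-- **The Gross–Zagier index relation with M2 and M7 split into printed sentences**: as `GrossZagierCusp` (TYZ Thm. 3.3
at `χ₀`, (B1) TYZ p. 749 through `ϕ`) with `CuspDisplays` replaced by `ParamCuspDisplays`.
[cite: TianYuanZhang2017, Thm. 3.3 (p. 739), p. 749, J751, §2 (p0007 L112), §3.2, Lemma 3.16]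
[cite: Tian2014, Def. 2.7, Prop. 2.1, p0003 L1–L5] -/
def GrossZagierParam (D : CMPointData n) (hn : n ≠ 0) : Prop :=
  ∃ (R : EPoint D.H) (L u : ℤ) (h₂ : ℕ) (w : EPoint D.H) (B : D.BridgeData), IsScriptL (2 * n) L ∧
    IsScriptL 1 u ∧ Odd u ∧ D.tyzThm33Chi0 hn R L u h₂ ∧ D.tyzTwoRSum R w ∧ B.ParamCuspDisplays w

/-- `GrossZagierParam ⟹ GrossZagierCusp`. [cite: Tian2014, p0003 L3–L5 (J119)] [cite: TianYuanZhang2017, §2 (p0007 L112), J751] -/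
theorem grossZagierCusp_of_grossZagierParam (D : CMPointData n) (hn : n ≠ 0) (h : D.GrossZagierParam hn) :
    D.GrossZagierCusp hn := by
  obtain ⟨R, L, u, h₂, w, B, hL, hu, huodd, h33, hB1, hP⟩ := h
  exact ⟨R, L, u, h₂, w, B, hL, hu, huodd, h33, hB1, B.cuspDisplays_of_paramCuspDisplays hP⟩

end CMPointData

/-- **THE SYSTEM FACT WITH M2 AND M7 SPLIT INTO PRINTED SENTENCES**: Tian's CM-point system on `𝒮⁻` with `Printed`
(Thm. 2.8 system), `GrossZagierParam` (TYZ Thm. 3.3 at `χ₀` + TYZ p. 749 through `ϕ` + the displays M1, M3, M4, M5, M6 +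
the predicate «degree-`2` modular parametrisation mapping `[∞]` to `0`» with «Such `f` is unique up to multiplication by
`−1`», «`f` is one», «`ϕ` is one» + TYZ's `τ` with «`τ(1/2) = [0]`» and «`ϕ_F` and `[1+i]` have the same kernel
`{0, τ(1)}`» + `𝓛(2n) ∈ ℤ`, `𝓛(1)` odd) and `GenusTheoryDisplays`. Existential over ONE system per `(p, q)`; implies
`tian2014_system_sMinus_cusp` (`tian2014_system_sMinus_cusp_of_param`), hence `…_maximal`, `…_bridged`, `…_split`,
`…_genus` and every enclosure form of the cell. Printed-but-unproved content = that of the cusp fact with the sign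
relation `f = ±ϕ` replaced by the three printed sentences of Tian p0003 / p0005 and TYZ p0007 / J751.
[cite: Tian2014, Def. 2.7, Thm. 2.8 (p0011 L25–L44 = J132), Prop. 2.1 (p0006 L25–L75), p0003 L1–L5, §2 (p0005 L77–L79), (4.8) (p0023 L46–L50), Notations (J122–123)]
[cite: TianYuanZhang2017, Thm. 3.3 (p. 739) and its proof (pp. 749–751), §2 (p0007 L112), §3.1, §3.2 (p0012 L8–L18), J747, J751, Lemma 3.16 (p0017 L98–L113), Thm. 1.1, Thm. 1.4] -/
def tian2014_system_sMinus_param : Prop :=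
  ∀ p q : ℕ, (hp : p.Prime) → (hq : q.Prime) → p % 8 = 5 → q % 4 = 3 → jacobiSym p q = -1 →
    ∃ D : CMPointData (p * q), D.Printed ∧
      D.GrossZagierParam (Nat.mul_ne_zero hp.ne_zero hq.ne_zero) ∧ D.GenusTheoryDisplays

/-- The param fact implies the cusp fact (M2 is a kernel theorem of Tian's uniqueness sentence at two printed instances).
[cite: Tian2014, p0003 L3–L5 (J119), §2 (p0005 L77–L79)] [cite: TianYuanZhang2017, §2 (p0007 L112), J751] -/
theorem tian2014_system_sMinus_cusp_of_param (h : tian2014_system_sMinus_param) :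
    tian2014_system_sMinus_cusp := by
  intro p q hp hq hp5 hq4 hj
  obtain ⟨D, hP, hG, hGen⟩ := h p q hp hq hp5 hq4 hj
  exact ⟨D, hP, D.grossZagierCusp_of_grossZagierParam _ hG, hGen⟩

/-- The param fact implies the maximal fact. [cite: Tian2014, p0003 L3–L5, Prop. 2.1] [cite: TianYuanZhang2017, §2, §3.2, Lemma 3.16] -/
theorem tian2014_system_sMinus_maximal_of_param (h : tian2014_system_sMinus_param) :
    tian2014_system_sMinus_maximal :=
  tian2014_system_sMinus_maximal_of_cusp (tian2014_system_sMinus_cusp_of_param h)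

end Literature.NumberTheory.EllipticCurves.Tian2014

end
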